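import Literature.LinearAlgebra.RootSystem.AffineWeylGroupLengthFormula
import HarnessLib

/-!
# The length of `w·T(d)`: `ℓ(gt(d)) = Σ_{α≻0, gα≻0} |m_α| + Σ_{α≻0, gα≺0} |m_α + 1|` (Iwahori–Matsumoto 1965 Proposition 1.23, right-translation form)

N. Iwahori, H. Matsumoto, *On some Bruhat decomposition and the structure of the Hecke rings of p-adic Chevalley groups*, Publ. Math. IHÉS
25 (1965) [IwahoriMatsumoto1965] (held `paper:doi-10-1007-bf02684396`), §1.9 Proposition 1.23 (PDF p. 17 = p. 252): «Let `d ∈ P`, `w ∈ W`. Then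
`λ(T(d)w) = Σ_{α>0, w⁻¹(α)>0} |(α, d)| + Σ_{α>0, w⁻¹(α)<0} |(α, d) - 1|`» (row g45-#4 `length_constVAdd_mul_affineHom_eq`), and Corollary 1.26 (p. 254), which
takes the extrema of `λ` over the cosets `w·T(d)`, `w ∈ W` («`Max_{w∈W} λ(w·T(d))` and `Min_{w∈W} λ(w·T(d))` are attained by unique elements»): since
`w·T(d) = T(wd)·w` (§1.2) and `(α, wd) = (w⁻¹α, d)`, Proposition 1.23 for `T(wd)w`, re-indexed by `α ↦ wα` and `α ↦ -α` on the second sum, reads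
`λ(w·T(d)) = Σ_{α>0, wα>0} |(α, d)| + Σ_{α>0, wα<0} |(α, d) + 1|`.
J. E. Humphreys, *Reflection Groups and Coxeter Groups* (1990) [Humphreys1990], §4.1 («`g t(λ) g⁻¹ = t(gλ)`»), §4.5 Theorem («`n = ℓ`»).

THIS FILE (lane `lit-hodgefound`, prover seat p40, generation 45, row g45-#15; THEOREMS ONLY — no definition, instance, notation or named fact; net
debt 0), CONVENTIONS of the `AffineWeylGroup*` files (weight space `M`, `Q`-translations `t(d) = AffineEquiv.constVAdd K M d` with `d ∈ Q` and integer
levels `m_α = ⟨d, α^∨⟩`, `ℓ` = p13's word length in the `wallReflection`s):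

* ★ `coroot'_smul_eq_inv_smul'` (`⟨gd, α^∨⟩ = m_{g⁻¹α}`), ★ `affineHom_mul_constVAdd_mk_eq` (`g·t(d) = t(gd)·g` as elements of `W_a`);
* ★★★ `length_affineHom_mul_constVAdd_eq` — `ℓ(g·t(d)) = Σ_{α≻0, gα≻0} |m_α| + Σ_{α≻0, gα≺0} |m_α + 1|` (Proposition 1.23 for `t(gd)g` plus the
  re-indexing; the antisymmetric difference of the two sides sums to `0` over all roots);
* ★★ `length_affineHom_mul_constVAdd_add_length_eq_of_forall_le` (for `d` regular antidominant, `m_α ≤ -1` on `Φ⁺`: `ℓ(g·t(d)) + ℓ(g) = ℓ(t(d))`; the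
  dominant counterpart `ℓ(g·t(d)) = ℓ(g) + ℓ(t(d))` is row g45-#6 `length_affineHom_mul_constVAdd_of_dominant`).

BY NAME, nothing restated: rows g45-#4 (`length_constVAdd_mul_affineHom_eq`, `length_constVAdd_eq`, `length_affineHom_eq_card_filter`), g44-#1 (`affineHom`,
`mul_constVAdd`, `linear_affineHom`, `constVAdd_mem_affineWeylGroup_of_mem_rootSpan`, `affineHom_mem_affineWeylGroup`, `smul_mem_rootSpan`),
`WeylGroupSimpleReflections` (`coroot'_smul_smul`, `smul_index_eq`), `WeylGroupFundamentalDomain` (`coroot'_indexNeg`), g45-#1 (`wallReflection`).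

## References

* [IwahoriMatsumoto1965] N. Iwahori, H. Matsumoto, Publ. Math. IHÉS 25 (1965) 5–48, §1.9 Proposition 1.23 (p. 252), Corollary 1.26 (p. 254), §1.2.
* [Humphreys1990] J. E. Humphreys, *Reflection Groups and Coxeter Groups*, CUP (1990), §4.1, §4.5 Theorem.
-/

noncomputable section

open Module Set Function
open Literature.GroupTheory.Coxeter Literature.GroupTheory.Coxeter.PreCoxeterSystem

namespace Literature.LinearAlgebra.RootSystem

namespace Base

variable {ι K M N : Type*} [Field K] [LinearOrder K] [IsStrictOrderedRing K] [AddCommGroup M] [Module K M]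
  [AddCommGroup N] [Module K N] [Fintype ι] [DecidableEq ι]
  {P : RootPairing ι K M N} [CharZero K] [P.IsCrystallographic] [P.IsReduced] (b : P.Base)

/-! ## §1 `w·T(d) = T(wd)·w` -/

section Conjugation

omit [LinearOrder K] [IsStrictOrderedRing K] [Fintype ι] [DecidableEq ι] [CharZero K] [P.IsCrystallographic] [P.IsReduced] in
/-- ★ The levels of `gd` are `α ↦ m_{g⁻¹α}`: `⟨gd, α^∨⟩ = ⟨d, (g⁻¹α)^∨⟩`. [cite: IwahoriMatsumoto1965, §1.6 ("(α, w(a)) = (w⁻¹(α), a)")] -/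
theorem coroot'_smul_eq_inv_smul' {d : M} {m : ι → ℤ} (hm : ∀ i, P.coroot' i d = m i) (g : P.Aut) (i : ι) :
    P.coroot' i (g • d) = m (g⁻¹ • i) := by
  rw [← hm, ← coroot'_smul_smul g (g⁻¹ • i) d, smul_inv_smul]

omit [LinearOrder K] [IsStrictOrderedRing K] [Fintype ι] [DecidableEq ι] [CharZero K] [P.IsCrystallographic] [P.IsReduced] in
/-- ★ **«`w·T(d) = T(wd)·w`»** as elements of `W_a` (`d ∈ Q`, `g ∈ W`; `gd ∈ Q`). [cite: IwahoriMatsumoto1965, §1.2 ("σT(d)σ⁻¹ = T(σd)")] [cite: Humphreys1990, §4.1 ("g t(λ) g⁻¹ = t(gλ)")] -/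
theorem affineHom_mul_constVAdd_mk_eq {d : M} (hd : d ∈ P.rootSpan ℤ) {g : P.Aut} (hg : g ∈ P.weylGroup) :
    ((⟨affineHom P g, affineHom_mem_affineWeylGroup P hg⟩ : affineWeylGroup P) *
        ⟨AffineEquiv.constVAdd K M d, constVAdd_mem_affineWeylGroup_of_mem_rootSpan P hd⟩ : affineWeylGroup P) =
      ⟨AffineEquiv.constVAdd K M (g • d) * affineHom P g,
        Subgroup.mul_mem _ (constVAdd_mem_affineWeylGroup_of_mem_rootSpan P (smul_mem_rootSpan P g hd)) (affineHom_mem_affineWeylGroup P hg)⟩ := by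
  apply Subtype.ext
  show affineHom P g * AffineEquiv.constVAdd K M d = AffineEquiv.constVAdd K M (g • d) * affineHom P g
  rw [mul_constVAdd, linear_affineHom]
  rfl

end Conjugation

/-! ## §2 The re-indexing -/

section Reindex

omit [LinearOrder K] [IsStrictOrderedRing K] [Fintype ι] [DecidableEq ι] [CharZero K] [P.IsCrystallographic] [P.IsReduced] in
/-- `g(-α) = -(gα)` on indices. [folklore] -/
private theorem smul_reflectionPerm_self_eq' (g : P.Aut) (i : ι) :
    g • P.reflectionPerm i i = P.reflectionPerm (g • i) (g • i) := by
  apply P.root.injective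
  rw [smul_index_eq, smul_index_eq, RootPairing.Equiv.root_indexEquiv_eq_smul, RootPairing.root_reflectionPerm,
    RootPairing.root_reflectionPerm, RootPairing.reflection_apply_self, RootPairing.reflection_apply_self, smul_neg,
    RootPairing.Equiv.root_indexEquiv_eq_smul]

omit [LinearOrder K] [IsStrictOrderedRing K] [DecidableEq ι] [CharZero K] [P.IsCrystallographic] [P.IsReduced] in
/-- Re-indexing by `α ↦ gα`: `Σ_α F(g⁻¹α, α) = Σ_α F(α, gα)`. [folklore] -/
private theorem sum_comp_inv_smul_eq' (g : P.Aut) (F : ι → ι → ℤ) :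
    ∑ i, F (g⁻¹ • i) i = ∑ i, F i (g • i) :=
  (Fintype.sum_equiv (MulAction.toPerm g) (fun i ↦ F i (g • i)) (fun i ↦ F (g⁻¹ • i) i)
    (fun i ↦ by rw [MulAction.toPerm_apply, inv_smul_smul])).symm

omit [LinearOrder K] [IsStrictOrderedRing K] [DecidableEq ι] [CharZero K] [P.IsCrystallographic] [P.IsReduced] in
/-- An antisymmetric function of the roots (`D(-α) = -D(α)`) sums to `0`. [folklore] -/
private theorem sum_eq_zero_of_antisymm (D : ι → ℤ) (hD : ∀ i, D (P.reflectionPerm i i) = -D i) : ∑ i, D i = 0 := by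
  letI := P.indexNeg
  have h : ∑ i, D i = ∑ i, D (-i) := (Equiv.sum_comp (Equiv.neg ι) D).symm
  have h2 : ∑ i, D (-i) = -∑ i, D i := by
    rw [← Finset.sum_neg_distrib]
    exact Finset.sum_congr rfl fun i _ ↦ hD i
  omega

omit [LinearOrder K] [IsStrictOrderedRing K] [DecidableEq ι] [P.IsCrystallographic] [P.IsReduced] in
/-- ★ **THE RE-INDEXING OF PROPOSITION 1.23**: for integer data `m` with `m_{-α} = -m_α` and any automorphism `g`,
`Σ_{α≻0} (g⁻¹α ≻ 0 ? |m_{g⁻¹α}| : |m_{g⁻¹α} - 1|) = Σ_{α≻0} (gα ≻ 0 ? |m_α| : |m_α + 1|)` — substitute `α ↦ gα`, then `α ↦ -α` on the terms with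
`α ≺ 0`. [cite: IwahoriMatsumoto1965, §1.6 ("Now since P_{α,k} = P_{−α,−k} we may assume always that α ∈ Δ⁺")] -/
theorem sum_filter_isPos_inv_smul_eq [DecidablePred b.IsPos] {m : ι → ℤ} (hms : ∀ i, m (P.reflectionPerm i i) = -m i) (g : P.Aut) :
    ∑ i ∈ Finset.univ.filter b.IsPos, (if b.IsPos (g⁻¹ • i) then |m (g⁻¹ • i)| else |m (g⁻¹ • i) - 1|) =
      ∑ i ∈ Finset.univ.filter b.IsPos, (if b.IsPos (g • i) then |m i| else |m i + 1|) := by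
  letI := P.indexNeg
  rw [Finset.sum_filter, Finset.sum_filter,
    sum_comp_inv_smul_eq' g (fun j i ↦ if b.IsPos i then (if b.IsPos j then |m j| else |m j - 1|) else 0), ← sub_eq_zero,
    ← Finset.sum_sub_distrib]
  refine sum_eq_zero_of_antisymm (P := P) _ fun i ↦ ?_
  -- the summand at `-α` is minus the summand at `α`
  have hgneg : b.IsPos (g • P.reflectionPerm i i) ↔ ¬ b.IsPos (g • i) := by
    rw [smul_reflectionPerm_self_eq']; exact RootPairing.Base.IsPos.neg_iff_not b (g • i)
  have hneg : b.IsPos (P.reflectionPerm i i) ↔ ¬ b.IsPos i := RootPairing.Base.IsPos.neg_iff_not b i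
  have hm1 : |m (P.reflectionPerm i i) - 1| = |m i + 1| := by
    rw [hms, show -m i - 1 = -(m i + 1) by ring, abs_neg]
  have hm2 : |m (P.reflectionPerm i i) + 1| = |m i - 1| := by
    rw [hms, show -m i + 1 = -(m i - 1) by ring, abs_neg]
  have hm3 : |m (P.reflectionPerm i i)| = |m i| := by rw [hms, abs_neg]
  by_cases hi : b.IsPos i <;> by_cases hg : b.IsPos (g • i)
  · rw [if_pos hg, if_pos hi, if_pos hi, if_pos hg, if_neg (hgneg.not.mpr (not_not.mpr hg)), if_neg (hneg.not.mpr (not_not.mpr hi))]; ring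
  · rw [if_neg hg, if_pos hi, if_neg hg, if_pos (hgneg.mpr hg), if_neg (hneg.not.mpr (not_not.mpr hi)), if_neg (hneg.not.mpr (not_not.mpr hi)),
      hm1]; ring
  · rw [if_pos hg, if_neg hi, if_neg hi, if_neg (hgneg.not.mpr (not_not.mpr hg)), if_pos (hneg.mpr hi), if_neg (hgneg.not.mpr (not_not.mpr hg)),
      hm2]; ring
  · rw [if_neg hg, if_neg hi, if_pos (hgneg.mpr hg), if_pos (hneg.mpr hi), if_pos (hneg.mpr hi), if_pos (hgneg.mpr hg), hm3]; ring

end Reindex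

/-! ## §3 The length of `g·t(d)` -/

section Length

/-- ★★★ **PROPOSITION 1.23 FOR `w·T(d)`: `ℓ(g·t(d)) = Σ_{α≻0, gα≻0} |m_α| + Σ_{α≻0, gα≺0} |m_α + 1|`** for `d ∈ Q` with levels `m_α = ⟨d, α^∨⟩` and
`g ∈ W` (`g·t(d) = t(gd)·g`, Proposition 1.23 for `t(gd)g`, re-indexed). [cite: IwahoriMatsumoto1965, §1.9 Proposition 1.23 and Corollary 1.26 ("λ(w·T(d))")] [cite: Humphreys1990, §4.5 Theorem] -/
theorem length_affineHom_mul_constVAdd_eq [Nonempty ι] [DecidablePred b.IsPos] {η : ι}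
    (hη : ∀ k, P.coroot η - P.coroot k ∈ AddSubmonoid.closure (P.coroot '' (b.support : Set ι))) {g : P.Aut} (hg : g ∈ P.weylGroup)
    {d : M} (hd : d ∈ P.rootSpan ℤ) {m : ι → ℤ} (hm : ∀ i, P.coroot' i d = m i) :
    (PreCoxeterSystem.length (wallReflection b η)
        ((⟨affineHom P g, affineHom_mem_affineWeylGroup P hg⟩ : affineWeylGroup P) *
          ⟨AffineEquiv.constVAdd K M d, constVAdd_mem_affineWeylGroup_of_mem_rootSpan P hd⟩) : ℤ) =
      ∑ i ∈ Finset.univ.filter b.IsPos, (if b.IsPos (g • i) then |m i| else |m i + 1|) := by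
  letI := P.indexNeg
  have hms : ∀ i, m (P.reflectionPerm i i) = -m i := fun i ↦ by
    have h := hm (P.reflectionPerm i i)
    rw [show P.reflectionPerm i i = -i from rfl, coroot'_indexNeg, hm] at h
    exact_mod_cast h.symm
  rw [affineHom_mul_constVAdd_mk_eq hd hg,
    length_constVAdd_mul_affineHom_eq b hη (smul_mem_rootSpan P g hd) hg (coroot'_smul_eq_inv_smul' hm g),
    sum_filter_isPos_inv_smul_eq b hms g]

/-- ★★ **`ℓ(g·t(d)) + ℓ(g) = ℓ(t(d))` FOR `d` REGULAR ANTIDOMINANT** (`m_α ≤ -1` for all `α ≻ 0`): then `|m_α + 1| = |m_α| - 1`, and `ℓ(g)` is the number of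
positive roots made negative by `g` (row g45-#4). [cite: IwahoriMatsumoto1965, §1.9 Proposition 1.23, Corollary 1.26 ("λ(w w⁽¹⁾T(d)) = λ(w⁽¹⁾T(d)) − n(w)")] [cite: Humphreys1990, §4.5 Theorem] -/
theorem length_affineHom_mul_constVAdd_add_length_eq_of_forall_le [Nonempty ι] {η : ι}
    (hη : ∀ k, P.coroot η - P.coroot k ∈ AddSubmonoid.closure (P.coroot '' (b.support : Set ι))) {g : P.Aut} (hg : g ∈ P.weylGroup)
    {d : M} (hd : d ∈ P.rootSpan ℤ) {m : ι → ℤ} (hm : ∀ i, P.coroot' i d = m i) (hneg : ∀ i, b.IsPos i → m i ≤ -1) :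
    PreCoxeterSystem.length (wallReflection b η)
        ((⟨affineHom P g, affineHom_mem_affineWeylGroup P hg⟩ : affineWeylGroup P) *
          ⟨AffineEquiv.constVAdd K M d, constVAdd_mem_affineWeylGroup_of_mem_rootSpan P hd⟩) +
        PreCoxeterSystem.length (wallReflection b η) ⟨affineHom P g, affineHom_mem_affineWeylGroup P hg⟩ =
      PreCoxeterSystem.length (wallReflection b η) ⟨AffineEquiv.constVAdd K M d, constVAdd_mem_affineWeylGroup_of_mem_rootSpan P hd⟩ := by
  classical
  have h1 := length_affineHom_mul_constVAdd_eq b hη hg hd hm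
  have h2 := length_constVAdd_eq b hη hd hm
  have h3 := length_affineHom_eq_card_filter b hη hg
  -- `Σ_{α≻0} (gα ≻ 0 ? |m| : |m + 1|) = Σ_{α≻0} |m| - #{α ≻ 0 ; gα ≺ 0}`
  have h4 : ∑ i ∈ Finset.univ.filter b.IsPos, (if b.IsPos (g • i) then |m i| else |m i + 1|) +
      (((Finset.univ.filter b.IsPos).filter (fun i ↦ ¬ b.IsPos (g • i))).card : ℤ) = ∑ i ∈ Finset.univ.filter b.IsPos, |m i| := by
    rw [Finset.card_filter, Nat.cast_sum, ← Finset.sum_add_distrib]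
    refine Finset.sum_congr rfl fun i hi ↦ ?_
    have hmi := hneg i (Finset.mem_filter.mp hi).2
    by_cases hgi : b.IsPos (g • i)
    · rw [if_pos hgi, if_neg (not_not.mpr hgi), Nat.cast_zero, add_zero]
    · rw [if_neg hgi, if_pos hgi, Nat.cast_one, abs_of_nonpos (by omega), abs_of_nonpos (by omega)]; ring
  have h5 : ((PreCoxeterSystem.length (wallReflection b η) ⟨affineHom P g, affineHom_mem_affineWeylGroup P hg⟩ : ℕ) : ℤ) =
      (((Finset.univ.filter b.IsPos).filter (fun i ↦ ¬ b.IsPos (g • i))).card : ℤ) := by exact_mod_cast h3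
  omega

end Length

end Base

end Literature.LinearAlgebra.RootSystem
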